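import Mathlib
import Summits.Ventures.AbcShadow.SH04.Statement

/-!
# Venture AbcShadow — SH-04 STATEMENTS, generic form: the pair `(p, n)` of [BVY04, Thm 1.6] does not occur

HONEST FRAMING. Statement file of the work-bound cell `abc-shadow` (row SH-04 of its census: the printed possibly-exceptional
pairs of [BVY04, Thm 1.6/1.7]; typer seat `abc-shadow-typ-1`, lineage g3). This file PROVES NOTHING about any equation: it types,
as a plain `Prop` with parameters, `SH04Pair p n` := "for every `α ≥ 1`, `xⁿ + p^α yⁿ = z³` has NO solution in pairwise coprime
integers `x, y, z` with `|xy| > 1`" — the conclusion of the tree's rendering of the printed theorem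
`Literature.NumberTheory.DiophantineGeometry.BennettVatsalYazdani2004.thm16` at one pair `(p, n)` (same binder shape as g2's
`SH04Pair47_13`, which is LITERALLY `SH04Pair 47 13`: `sh04Pair_47_13_iff` is `Iff.rfl`). Bookkeeping proved here (pure logic /
kernel evaluation): what print already gives (`sh04Pair_of_thm16`: outside the exceptional list and the clause `n ∣ p² − 1`,
Theorem 1.6 as printed IS `SH04Pair p n`); the seven pairs this lineage types next — `sh04LStarPairs = [(13,19), (43,13), (61,61),
(67,73), (79,97), (97,13), (97,79)]`, the printed exceptions the cell closes by the L\* route (`SH04/LStar.lean`) — are on print's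
list, have `p ∈ thm16Primes`, and are NOT covered by `n ∣ p² − 1` (`sh04LStarPairs_listed`); and the generic sharpening lemma
`thm16_erase_of_pair` (Theorem 1.6 as printed + `SH04Pair p n` ⇒ Theorem 1.6 with `(p, n)` struck from the exception list), of which
g2's `thm16_erase_47_13` is the instance `(47, 13)`. ADJACENT results (generalized Fermat, signature `(n, n, 3)`), NOT abc: nothing
here is a claim on the abc conjecture or on any summit; no side on IUT.
-/

namespace Summit.Ventures.AbcShadow

open Literature.NumberTheory.DiophantineGeometry.BennettVatsalYazdani2004 (thm16 thm16Exceptional thm16Primes)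

/-- **SH-04, generic pair target** `SH04Pair p n`: for every `α ≥ 1` the equation `xⁿ + p^α · yⁿ = z³` has NO solution in pairwise
coprime integers `x, y, z` with `|xy| > 1` — the conclusion of [BVY04, Thm 1.6] at the pair `(p, n)` (print asserts it for prime
`n ≥ 11`, `p ∈ thm16Primes`, unless, possibly, `n ∣ p² − 1` or `(p, n) ∈ thm16Exceptional`). Plain `Prop`; nothing is asserted.
ADJACENT, NOT abc. [cite: BennettVatsalYazdani2004, Thm 1.6 p.1400 (conclusion at one pair (p, n))] -/
def SH04Pair (p n : ℕ) : Prop :=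
  ∀ α : ℕ, 0 < α → ∀ x y z : ℤ, IsCoprime x y → IsCoprime x z → IsCoprime y z → 1 < |x * y| →
    x ^ n + (p : ℤ) ^ α * y ^ n ≠ z ^ 3

/-- g2's target for the struck exception `(47, 13)` is literally the instance `SH04Pair 47 13`. [folklore] -/
theorem sh04Pair_47_13_iff : SH04Pair 47 13 ↔ SH04Pair47_13 := Iff.rfl

/-- **What print gives** [cite: BennettVatsalYazdani2004, Thm 1.6 p.1400]: for prime `n ≥ 11` and `p ∈ thm16Primes`, if `n ∤ p² − 1`
and `(p, n)` is not on the printed possibly-exceptional list, Theorem 1.6 as printed is exactly `SH04Pair p n`. -/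
theorem sh04Pair_of_thm16 (h16 : thm16) {p n : ℕ} (hn : n.Prime) (h11 : 11 ≤ n) (hp : p ∈ thm16Primes)
    (hndvd : ¬ (n ∣ p ^ 2 - 1)) (hexc : (p, n) ∉ thm16Exceptional) : SH04Pair p n :=
  fun α hα x y z hxy hxz hyz hbig => h16 n hn h11 p hp α hα hndvd hexc x y z hxy hxz hyz hbig

/-- The seven printed possibly-exceptional pairs of [BVY04, Thm 1.6] that the cell `abc-shadow` closes by the L\* route
(congruence of the unique [Prop 4.2]-survivor with the CM form 27a1 + [Prop 4.3] read level-free; `SH04/LStar.lean`), in print's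
order: `(13,19), (43,13), (61,61), (67,73), (79,97), (97,13), (97,79)`. (The remaining printed pairs: `(47,13)` closed by [Prop 4.2]
alone — g2's `sh04_47_13_v2`; `(29,11)`, `(59,11)` NOT closed — genuine non-CM obstructions, class L in the census.)
[cite: BennettVatsalYazdani2004, Thm 1.6 p.1400 (seven of the ten listed pairs)] -/
def sh04LStarPairs : List (ℕ × ℕ) := [(13, 19), (43, 13), (61, 61), (67, 73), (79, 97), (97, 13), (97, 79)]

/-- Bookkeeping (kernel evaluation) [cite: BennettVatsalYazdani2004, Thm 1.6 p.1400]: each of the seven pairs has `p` among the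
primes of Theorem 1.6, IS on print's possibly-exceptional list, has prime `n ≥ 11`, and is NOT covered by the other printed escape
clause `n ∣ p² − 1` — so `SH04Pair p n` is exactly what print leaves open at each of them. -/
theorem sh04LStarPairs_listed :
    ∀ pn ∈ sh04LStarPairs, pn.1 ∈ thm16Primes ∧ pn ∈ thm16Exceptional ∧ pn.2.Prime ∧ 11 ≤ pn.2 ∧ ¬ (pn.2 ∣ pn.1 ^ 2 - 1) := by
  decide

/-- **[BVY04, Thm 1.6] sharpened at one pair (pure logic).** If Theorem 1.6 holds as printed and the pair `(p₀, n₀)` does not occur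
(`SH04Pair p₀ n₀`), then Theorem 1.6 holds with `(p₀, n₀)` struck from the exception list (`thm16Exceptional.erase (p₀, n₀)`); g2's
`thm16_erase_47_13` is the instance `(47, 13)`. Iterating it strikes any set of closed pairs. [cite: BennettVatsalYazdani2004, Thm 1.6 p.1400] -/
theorem thm16_erase_of_pair (h16 : thm16) {p₀ n₀ : ℕ} (h : SH04Pair p₀ n₀) :
    ∀ n : ℕ, n.Prime → 11 ≤ n → ∀ p ∈ thm16Primes, ∀ α : ℕ, 0 < α →
      ¬ (n ∣ p ^ 2 - 1) → (p, n) ∉ thm16Exceptional.erase (p₀, n₀) →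
      ∀ x y z : ℤ, IsCoprime x y → IsCoprime x z → IsCoprime y z → 1 < |x * y| →
      x ^ n + (p : ℤ) ^ α * y ^ n ≠ z ^ 3 := by
  intro n hn h11 p hp α hα hndvd hexc x y z hxy hxz hyz hbig
  by_cases hpn : (p, n) = (p₀, n₀)
  · obtain ⟨hp0, hn0⟩ := Prod.mk.injEq p n p₀ n₀ ▸ hpn
    subst hp0 hn0
    exact h α hα x y z hxy hxz hyz hbig
  · exact h16 n hn h11 p hp α hα hndvd (fun hmem => hexc (Finset.mem_erase.mpr ⟨hpn, hmem⟩)) x y z hxy hxz hyz hbig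

/-- **The exception set of [BVY04, Thm 1.6] as a parameter (pure logic).** `Thm16With E` := Theorem 1.6 as printed but with the
possibly-exceptional list replaced by the finite set `E`; `thm16 = Thm16With thm16Exceptional` definitionally (`thm16With_printed`).
Used to state "Theorem 1.6 with the closed pairs struck" for several pairs at once (`thm16With_of_pairs`). Nothing is asserted.
[cite: BennettVatsalYazdani2004, Thm 1.6 p.1400 (statement with a variable exception list)] -/
def Thm16With (E : Finset (ℕ × ℕ)) : Prop :=
  ∀ n : ℕ, n.Prime → 11 ≤ n → ∀ p ∈ thm16Primes, ∀ α : ℕ, 0 < α →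
    ¬ (n ∣ p ^ 2 - 1) → (p, n) ∉ E →
    ∀ x y z : ℤ, IsCoprime x y → IsCoprime x z → IsCoprime y z → 1 < |x * y| →
    x ^ n + (p : ℤ) ^ α * y ^ n ≠ z ^ 3

/-- Print's Theorem 1.6 is `Thm16With` at the printed list. [cite: BennettVatsalYazdani2004, Thm 1.6 p.1400] -/
theorem thm16With_printed : Thm16With thm16Exceptional ↔ thm16 := Iff.rfl

/-- **Striking closed pairs (pure logic).** If Theorem 1.6 holds with exception set `E` and every pair of `E` outside `E'` does not
occur (`SH04Pair`), then Theorem 1.6 holds with exception set `E'`. [cite: BennettVatsalYazdani2004, Thm 1.6 p.1400] -/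
theorem thm16With_of_pairs {E E' : Finset (ℕ × ℕ)} (hE : Thm16With E)
    (hclosed : ∀ pn ∈ E, pn ∉ E' → SH04Pair pn.1 pn.2) : Thm16With E' := by
  intro n hn h11 p hp α hα hndvd hexc x y z hxy hxz hyz hbig
  by_cases hmem : (p, n) ∈ E
  · exact hclosed (p, n) hmem hexc α hα x y z hxy hxz hyz hbig
  · exact hE n hn h11 p hp α hα hndvd hmem x y z hxy hxz hyz hbig

end Summit.Ventures.AbcShadow
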